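/-
Copyright (c) 2026. All rights reserved.
Released under Apache 2.0 license as described in the file LICENSE.
Authors: abc-iut cell, campaign-S prover seat abc-iut-S7.
-/
import Literature.IUT.LogVolume.TensorPacketHaar
import Literature.IUT.LogVolume.PadicBoxVolume
import HarnessLib

/-!
# Scaling of the tensor-packet log-volume through one factor: `μ^log(ι_i(g)·A) = μ^log(A) + log ‖g‖`

The "action through a tensor factor" formula for the log-volume on `V = ⊗_{ℚ_p} k_i`
(`TensorPacketHaar.lean`): Dupuy–Hilado, arXiv:2004.13228, §3.7 "`log μ̄_{(v_0,…,v_{r−1})}(a_{v_{r−1}}·U)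
= ln|a_{v_{r−1}}|_p + log μ̄(U)`, where the action of `a_{v_{r−1}}` on `K_{v_0} ⊗ ⋯ ⊗ K_{v_{r−1}}` is through
the `r`th tensor factor" with (3.4) `ln|a|_p = −ord_v(a)·ln|κ(v)|/[F_{0,v}:ℚ_p]` (= `log ‖a‖` for the
`ℚ_p`-normalised absolute value `‖p‖ = p⁻¹`); in [IUTchIV] this is the bookkeeping "`p^λ·M`, `ord(p^λ) = λ`"
of Prop. 1.2/1.4 (e.g. `μ^log(p^{−b_I}·(R_I)^∼) = b_I·log p`).  PROVED here from Haar measure, with no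
decomposition of `V` into fields:

* `distribHaarChar_iota_of_norm_eq_one` — a unit `u ∈ 𝒪_{k_i}^×` has modulus `1` on `V` (it preserves
  the compact open `R_I`);
* `distribHaarChar_iota_prime` — `p ∈ k_i` has modulus `p^{−dim V}` (it acts as the scalar `p`);
* `log_distribHaarChar_iota` — **`log mod_V(ι_i(g)) = dim V · log ‖g‖` for every `g ∈ k_i^×`**: the
  defect is a homomorphism `k_i^× → ℝ` vanishing on `𝒪^×` and on `p = ϖ^{e}·w`, hence on a uniformizer
  `ϖ` (divide by `e`), hence everywhere (`g = ϖ^m·w`);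
* `tensorLogVolume_iota_smul` — **`μ^log(ι_i(g)·A) = μ^log(A) + log ‖g‖`** for `A` of positive finite
  volume, and the `ord` form `tensorLogVolume_iota_smul_of_norm_eq_rpow` (`‖g‖ = p^{−λ}` ⇒ `… − λ·log p`);
* `tensorLogVolume_padic_smul` / `tensorLogVolume_ppow_smul` — scalars: `μ^log(u·A) = μ^log(A) + log ‖u‖`
  for `u ∈ ℚ_p^×`, in particular `μ^log(p^n·A) = μ^log(A) − n·log p` for S1's `ppow n`, `n ∈ ℤ`.

[cite: DupuyHilado2025, §3.4, §3.7] [cite: Mochizuki2012, IUTchIV Prop. 1.4 (i) p. 13]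
Deliberately NOT here: anything about [IUTchIII] Cor. 3.12.
-/

noncomputable section

open MeasureTheory Set Module
open scoped NNReal ENNReal Pointwise TensorProduct NormedField
open Literature.NumberTheory.GaloisRepresentations.Ultrametric
open Literature.NumberTheory.GaloisRepresentations.Ultrametric.PadicUniformizer

namespace Literature.IUT.LogVolume

variable (p : ℕ) [Fact p.Prime]
variable {I : Type} [Fintype I] [DecidableEq I]
variable (k : I → Type) [∀ i, NontriviallyNormedField (k i)] [∀ i, NormedAlgebra ℚ_[p] (k i)]
  [∀ i, IsUltrametricDist (k i)] [∀ i, ProperSpace (k i)] [Nonempty I]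

/-- `ι_i` on units: `k_i^× → V^×`. [cite: DupuyHilado2025, §3.7] -/
def iotaUnits (i : I) : (k i)ˣ →* (PacketAlgebra p k)ˣ := Units.map (iota p k i : k i →* PacketAlgebra p k)

omit [Fintype I] [∀ i, IsUltrametricDist (k i)] [∀ i, ProperSpace (k i)] [Nonempty I] in
/-- Unfolding `iotaUnits`. [cite: DupuyHilado2025, §3.7] -/
@[simp] theorem coe_iotaUnits (i : I) (g : (k i)ˣ) : (iotaUnits p k i g : PacketAlgebra p k) = iota p k i g :=
  rfl

omit [Fintype I] [∀ i, IsUltrametricDist (k i)] [∀ i, ProperSpace (k i)] [Nonempty I] in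
/-- The action of `ι_i(g) ∈ V^×` on subsets of `V` is left multiplication by `ι_i(g)`.
[cite: DupuyHilado2025, §3.7] -/
theorem iotaUnits_smul_set (i : I) (g : (k i)ˣ) (A : Set (PacketAlgebra p k)) :
    iotaUnits p k i g • A = (fun x => iota p k i g * x) '' A := by
  ext x; simp [Set.mem_smul_set, Units.smul_def]

/-- **Units of `𝒪_{k_i}` have modulus `1`** on `V`: `ι_i(u)·R_I = R_I` for `‖u‖ = 1`.
[cite: DupuyHilado2025, §3.7] -/
theorem distribHaarChar_iota_of_norm_eq_one (i : I) {u : (k i)ˣ} (hu : ‖(u : k i)‖ = 1) :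
    distribHaarChar (PacketAlgebra p k) (iotaUnits p k i u) = 1 := by
  let Λ := integerStructure p k
  have h0 : Λ.haar (integerPacket p k : Set (PacketAlgebra p k)) ≠ 0 := by
    rw [← coe_integerStructure, Λ.haar_self]; exact one_ne_zero
  have ht : Λ.haar (integerPacket p k : Set (PacketAlgebra p k)) ≠ ∞ := by
    rw [← coe_integerStructure, Λ.haar_self]; exact ENNReal.one_ne_top
  refine distribHaarChar_eq_of_measure_smul_eq_mul (μ := Λ.haar) h0 ht ?_
  rw [iotaUnits_smul_set, iota_mul_integerPacket_of_norm_eq_one p k i hu, ENNReal.coe_one, one_mul]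

omit [Fintype I] [∀ i, IsUltrametricDist (k i)] [∀ i, ProperSpace (k i)] [Nonempty I] in
/-- `p` as a unit of `k_i` maps to the scalar `p` of `V`. [cite: DupuyHilado2025, §3.7] -/
theorem coe_iotaUnits_primeUnit (i : I) :
    (iotaUnits p k i (primeUnit p (k i)) : PacketAlgebra p k) = algebraMap ℚ_[p] (PacketAlgebra p k) p := by
  rw [coe_iotaUnits, coe_primeUnit, ← map_natCast (algebraMap ℚ_[p] (k i)) p, AlgHom.commutes,
    map_natCast]

/-- **`p ∈ k_i` has modulus `p^{−dim V}`** on `V` (it acts as the scalar `p`, `distribHaarChar_p_smul`).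
[cite: DupuyHilado2025, §3.7] -/
theorem distribHaarChar_iota_prime (i : I) :
    distribHaarChar (PacketAlgebra p k) (iotaUnits p k i (primeUnit p (k i))) =
      ((p : ℝ≥0)⁻¹) ^ finrank ℚ_[p] (PacketAlgebra p k) := by
  let Λ := integerStructure p k
  have h0 : Λ.haar (integerPacket p k : Set (PacketAlgebra p k)) ≠ 0 := by
    rw [← coe_integerStructure, Λ.haar_self]; exact one_ne_zero
  have ht : Λ.haar (integerPacket p k : Set (PacketAlgebra p k)) ≠ ∞ := by
    rw [← coe_integerStructure, Λ.haar_self]; exact ENNReal.one_ne_top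
  refine distribHaarChar_eq_of_measure_smul_eq_mul (μ := Λ.haar) h0 ht ?_
  -- the two actions (`ι_i(p) ∈ V^×` and `p ∈ ℚ_p^×`) move `R_I` to the same set
  have hset : iotaUnits p k i (primeUnit p (k i)) • (integerPacket p k : Set (PacketAlgebra p k)) =
      PadicUniformizer.varpi p • (integerPacket p k : Set (PacketAlgebra p k)) := by
    ext x
    simp only [Set.mem_smul_set, Units.smul_def, smul_eq_mul, coe_iotaUnits_primeUnit,
      PadicUniformizer.varpi_val, Algebra.smul_def, map_natCast]
  rw [hset, ← distribHaarChar_mul, PadicModule.distribHaarChar_p_smul p (PacketAlgebra p k)]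

/-- The **log-defect** `D_i(g) := log mod_V(ι_i(g)) − dim V · log ‖g‖`, as a homomorphism
`k_i^× → (ℝ, +)`. [cite: DupuyHilado2025, §3.7] -/
def logDefect (i : I) : (k i)ˣ →* Multiplicative ℝ where
  toFun g := Multiplicative.ofAdd
    (Real.log (distribHaarChar (PacketAlgebra p k) (iotaUnits p k i g) : ℝ) -
      finrank ℚ_[p] (PacketAlgebra p k) * Real.log ‖(g : k i)‖)
  map_one' := by simp
  map_mul' g h := by
    rw [← ofAdd_add]
    congr 1
    have hg : (distribHaarChar (PacketAlgebra p k) (iotaUnits p k i g) : ℝ) ≠ 0 :=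
      (NNReal.coe_pos.mpr (distribHaarChar_pos)).ne'
    have hh : (distribHaarChar (PacketAlgebra p k) (iotaUnits p k i h) : ℝ) ≠ 0 :=
      (NNReal.coe_pos.mpr (distribHaarChar_pos)).ne'
    rw [map_mul, map_mul, NNReal.coe_mul, Real.log_mul hg hh, Units.val_mul, norm_mul,
      Real.log_mul (norm_ne_zero_iff.mpr g.ne_zero) (norm_ne_zero_iff.mpr h.ne_zero)]
    ring

omit [Nonempty I] in
/-- Unfolding `logDefect`. [cite: DupuyHilado2025, §3.7] -/
theorem toAdd_logDefect (i : I) (g : (k i)ˣ) :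
    (logDefect p k i g).toAdd =
      Real.log (distribHaarChar (PacketAlgebra p k) (iotaUnits p k i g) : ℝ) -
        finrank ℚ_[p] (PacketAlgebra p k) * Real.log ‖(g : k i)‖ := rfl

/-- The log-defect vanishes on units of norm `1`. [cite: DupuyHilado2025, §3.7] -/
theorem logDefect_of_norm_eq_one (i : I) {u : (k i)ˣ} (hu : ‖(u : k i)‖ = 1) :
    (logDefect p k i u).toAdd = 0 := by
  rw [toAdd_logDefect, distribHaarChar_iota_of_norm_eq_one p k i hu, hu]
  simp

/-- The log-defect vanishes on `p`. [cite: DupuyHilado2025, §3.7] -/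
theorem logDefect_primeUnit (i : I) : (logDefect p k i (primeUnit p (k i))).toAdd = 0 := by
  rw [toAdd_logDefect, distribHaarChar_iota_prime, coe_primeUnit, norm_prime]
  have hp : (0 : ℝ) < p := by exact_mod_cast (Fact.out : p.Prime).pos
  push_cast
  rw [Real.log_pow, Real.log_inv]
  ring

/-- The log-defect vanishes on a uniformizer (`e·D(ϖ) = D(ϖ^e) = D(p) − D(w) = 0`).
[cite: DupuyHilado2025, §3.7] -/
theorem logDefect_uniformizer (i : I) {ϖ : (k i)ˣ} (hϖ : IsUniformizer ϖ) :
    (logDefect p k i ϖ).toAdd = 0 := by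
  -- `p = ϖ^e · w` with `‖w‖ = 1`
  have hnorm : ‖((primeUnit p (k i) : (k i)ˣ) : k i)‖ = ‖(ϖ : k i)‖ ^ ((absRamificationIdx p (k i) : ℕ) : ℤ) := by
    rw [coe_primeUnit, zpow_natCast, norm_prime_eq_norm_pow p (k i) hϖ]
  obtain ⟨w, hw, hpw⟩ := exists_eq_zpow_mul_of_norm_eq ϖ (primeUnit p (k i)) _ hnorm
  have h := logDefect_primeUnit p k i
  rw [hpw, map_mul, toAdd_mul, map_zpow, toAdd_zpow, logDefect_of_norm_eq_one p k i hw, add_zero,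
    zsmul_eq_mul] at h
  have he : ((absRamificationIdx p (k i) : ℕ) : ℝ) ≠ 0 := by
    exact_mod_cast (absRamificationIdx_pos p (k i)).ne'
  push_cast at h
  exact (mul_eq_zero.mp h).resolve_left he

/-- **The log-defect vanishes identically**: `g = ϖ^m·w`. [cite: DupuyHilado2025, §3.7] -/
theorem logDefect_eq_zero (i : I) (g : (k i)ˣ) : (logDefect p k i g).toAdd = 0 := by
  obtain ⟨ϖ, hϖ⟩ := exists_isUniformizer (F := k i)
  obtain ⟨m, hm⟩ := hϖ.2 g
  obtain ⟨w, hw, rfl⟩ := exists_eq_zpow_mul_of_norm_eq ϖ g m hm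
  rw [map_mul, toAdd_mul, map_zpow, toAdd_zpow, logDefect_uniformizer p k i hϖ,
    logDefect_of_norm_eq_one p k i hw, smul_zero, add_zero]

/-- **`log mod_V(ι_i(g)) = dim_{ℚ_p} V · log ‖g‖`** for every `g ∈ k_i^×`: the Haar modulus of
multiplication by `g` through the `i`-th tensor factor (= `|N_{V/ℚ_p}(ι_i g)|_p`, Weil's module).
[cite: DupuyHilado2025, §3.7] -/
theorem log_distribHaarChar_iota (i : I) (g : (k i)ˣ) :
    Real.log (distribHaarChar (PacketAlgebra p k) (iotaUnits p k i g) : ℝ) =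
      finrank ℚ_[p] (PacketAlgebra p k) * Real.log ‖(g : k i)‖ := by
  have h := logDefect_eq_zero p k i g
  rw [toAdd_logDefect] at h
  linarith

/-- **Action through a tensor factor** (Dupuy–Hilado (3.7)): for `g ∈ k_i^×` and `A ⊆ V` of positive
finite volume, `μ^log(ι_i(g)·A) = μ^log(A) + log ‖g‖`. [cite: DupuyHilado2025, §3.7] -/
theorem tensorLogVolume_iota_smul (i : I) (g : (k i)ˣ) {A : Set (PacketAlgebra p k)}
    (hA : 0 < (integerStructure p k).haar A) (hA' : (integerStructure p k).haar A < ∞) :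
    tensorLogVolume p k ((fun x => iota p k i g * x) '' A) = tensorLogVolume p k A + Real.log ‖(g : k i)‖ := by
  let Λ := integerStructure p k
  have hn : (0 : ℝ) < finrank ℚ_[p] (PacketAlgebra p k) := by exact_mod_cast finrank_packet_pos p k
  have himg : ∀ B : Set (PacketAlgebra p k),
      packetMulLeftEquiv p k (iotaUnits p k i g) '' B = (fun x => iota p k i g * x) '' B := fun B => by
    rw [packetMulLeftEquiv_image, iotaUnits_smul_set]
  rw [← himg, tensorLogVolume_image p k _ hA hA', himg, ← iotaUnits_smul_set,
    IntegralStructure.normalizedLogVolume, IntegralStructure.logVolume, ← distribHaarChar_mul,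
    ← coe_integerStructure, Λ.haar_self, mul_one, ENNReal.coe_toReal, log_distribHaarChar_iota]
  field_simp

/-- The same in `ord` form: if `‖g‖ = p^{−λ}` ("`g = p^λ`", `ord(g) = λ`) then
`μ^log(ι_i(g)·A) = μ^log(A) − λ·log p` — e.g. `μ^log(p^λ·(R_I)^∼) = −λ·log p` ([IUTchIV] Prop. 1.4),
`log μ̄(a·U) = −ord_v(a)·ln|κ(v)|/n_v + log μ̄(U)` (Dupuy–Hilado (3.7)/(3.4)).
[cite: Mochizuki2012, IUTchIV Prop. 1.4 (i) p. 13] -/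
theorem tensorLogVolume_iota_smul_of_norm_eq_rpow (i : I) (g : (k i)ˣ) {lam : ℝ}
    (hg : ‖(g : k i)‖ = (p : ℝ) ^ (-lam)) {A : Set (PacketAlgebra p k)}
    (hA : 0 < (integerStructure p k).haar A) (hA' : (integerStructure p k).haar A < ∞) :
    tensorLogVolume p k ((fun x => iota p k i g * x) '' A) = tensorLogVolume p k A - lam * Real.log p := by
  have hp : (0 : ℝ) < p := by exact_mod_cast (Fact.out : p.Prime).pos
  rw [tensorLogVolume_iota_smul p k i g hA hA', hg, Real.log_rpow hp]
  ring

/-! ### Scalars `u ∈ ℚ_p^×` and the powers `p^n` -/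

/-- **Scalars**: for `u ∈ ℚ_p^×` and `A ⊆ V` of positive finite volume, `μ^log(u·A) = μ^log(A) + log ‖u‖`
(the Haar modulus of a scalar on the `n`-dimensional `V` is `‖u‖^n`, `distribHaarChar_units_smul`).
[cite: Mochizuki2012, IUTchIV Prop. 1.4 (i) p. 13] -/
theorem tensorLogVolume_padic_smul (u : ℚ_[p]ˣ) {A : Set (PacketAlgebra p k)}
    (hA : 0 < (integerStructure p k).haar A) (hA' : (integerStructure p k).haar A < ∞) :
    tensorLogVolume p k ((u : ℚ_[p]) • A) = tensorLogVolume p k A + Real.log ‖(u : ℚ_[p])‖ := by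
  let Λ := integerStructure p k
  have hn : (0 : ℝ) < finrank ℚ_[p] (PacketAlgebra p k) := by exact_mod_cast finrank_packet_pos p k
  let w : (PacketAlgebra p k)ˣ := Units.map (algebraMap ℚ_[p] (PacketAlgebra p k) : ℚ_[p] →* _) u
  have himg : ∀ B : Set (PacketAlgebra p k), packetMulLeftEquiv p k w '' B = (u : ℚ_[p]) • B := fun B => by
    rw [packetMulLeftEquiv_image]
    ext x
    simp only [Set.mem_smul_set, Units.smul_def, smul_eq_mul, Algebra.smul_def, w, Units.coe_map,
      MonoidHom.coe_coe]
  have hset : (u : ℚ_[p]) • (integerPacket p k : Set (PacketAlgebra p k)) = u • (integerPacket p k : Set _) := by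
    ext x; simp only [Set.mem_smul_set, Units.smul_def]
  rw [← himg, tensorLogVolume_image p k _ hA hA', himg, hset, IntegralStructure.normalizedLogVolume,
    IntegralStructure.logVolume, ← distribHaarChar_mul, ← coe_integerStructure, Λ.haar_self, mul_one,
    ENNReal.coe_toReal, PadicModule.distribHaarChar_units_smul p (PacketAlgebra p k),
    distribHaarChar_padic_eq_nnnorm, NNReal.coe_pow, coe_nnnorm, Real.log_pow]
  field_simp

omit [Fintype I] [DecidableEq I] [∀ i, IsUltrametricDist (k i)] [∀ i, ProperSpace (k i)] [Nonempty I] in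
/-- `p^n • A = (p^n : ℚ_p^×) • A`: S1's `ppow n ∈ V` acts as the scalar `p^n`.
[cite: Mochizuki2012, IUTchIV Prop. 1.2 p. 10] -/
theorem ppow_smul_eq (n : ℤ) (A : Set (PacketAlgebra p k)) :
    ppow p k n • A = (((varpi p) ^ n : ℚ_[p]ˣ) : ℚ_[p]) • A := by
  ext x
  simp only [Set.mem_smul_set, smul_eq_mul, ppow, Algebra.smul_def, Units.val_zpow_eq_zpow_val, varpi_val]

/-- **`μ^log(p^n·A) = μ^log(A) − n·log p`** (`n ∈ ℤ`, S1's `ppow n`; "`μ^log(p·(R_E)^∼) = −log(p)`").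
[cite: Mochizuki2012, IUTchIV Prop. 1.4 (i) p. 13] -/
theorem tensorLogVolume_ppow_smul (n : ℤ) {A : Set (PacketAlgebra p k)}
    (hA : 0 < (integerStructure p k).haar A) (hA' : (integerStructure p k).haar A < ∞) :
    tensorLogVolume p k (ppow p k n • A) = tensorLogVolume p k A - n * Real.log p := by
  have hp : (0 : ℝ) < p := by exact_mod_cast (Fact.out : p.Prime).pos
  rw [ppow_smul_eq, tensorLogVolume_padic_smul p k _ hA hA', Units.val_zpow_eq_zpow_val, varpi_val,
    norm_zpow, Padic.norm_p, Real.log_zpow, Real.log_inv]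
  ring

end Literature.IUT.LogVolume

end
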